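import Literature.MathematicalPhysics.QuantumFieldTheory.Balaban1983to89.Beta.ResolventComposition
import Literature.MathematicalPhysics.QuantumFieldTheory.Balaban1983to89.B4Reflection242

/-!
# `BalabanUV.Beta.GAN24.TaylorLamLegPhi` — binder row G-an2-4 / (CONV-C), S-slot road «S3-Taylor», generic leaf **L1♯-b** (sibling of L1
# `GAN24/TaylorLamLeg` p205991 — independent imports, neither file imports the other; register tag «TAYLOR-L1*»): THE Φ-PART OF THE LAGRANGE-ROW MULTIPLIER-RESPONSE LEG, SMEARED THROUGH `𝒬ᵀ`,
# IN THE K-SLOT mm CURRENCY — unit `N·N^{−2(d+1)} = N^{−(2d+1)}`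

NOT IN PRINT; OUR PROOF ATTEMPT (unit b2b-balaban-gan24-formalise-leaf-13, gen 17).  WHY THIS FILE: three concordant power counts (leaf-09-g15 CLAIMS
l.4662, leaf-10-g11 l.4674, leaf-13-g17 l.4692) showed that the (N1)-currency leg L1 (`TaylorLamLeg.abs_lamCoeffOf_KInv_le_unit`, unit `N^{−(d+2)}`)
under-delivers by `N^{d−1}` for the Λ rows of `SKELETON-S3.md` v1.0 §12.2; the sharp leg goes through the Euler–Lagrange identity
`KernelSpecInstance.wH_EL` (`d*d` of the minimiser column `= 𝒬ᵀ wΦ + dδd wM`; the identity `lamCoeffOf_KInv_eq_EL` is the ROW-Λt holder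
leaf-10-g11's), whose Φ-part is `−(contourSumAdj N (wΦ(·, μ, ·)))_{κ″}(u − N•yy)`.  THIS file bounds that Φ-part generically (asked for by leaf-10-g11,
CLAIMS l.4711 «(L1♯-b) YES PLEASE — take it»); the gauge part `dδd wM` is the located residual («(N1-gauge)» or structural), NOT touched here.
HONEST FRAMING (cell contract, verbatim): «discharging `BetaPertH` makes Bałaban's UV stability UNCONDITIONAL — a real constructive-QFT result;
it is NOT the continuum limit and NOT the Clay problem.»  HONEST DEPENDENCY (verbatim): «continuum YM on T⁴ ⇐ BetaPertH ∧ nine spine estimates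
(0/9 proved); BetaPertH ⇐ (D1) ∧ (D4) ∧ CAP+tail; G-an2-4 gates asym, D1 and NE2/3/4.»  [folklore] finite bookkeeping over an2's
`AffineReproduction.contourSumAdj`, `OneStepResolventKernel.KInv` (`KInv_inr_inr_coarse`), `KernelSpecInstance.wΦ`; generic `d`, generic `N`;
0 cite, 0 def, 0 `def … : Prop`; no estimate of (N3)∕the K-slot itself (hypotheses in its literal shape); NOTHING of (hS, hSall) ∕ «E3Shape» is
discharged.  NOT summit progress.

WHAT IS PROVED (0 sorry): `contourSumAdj_eq_sum_quo` (`(𝒬ᵀφ)_κ(x) = Σ_{s<N} φ_κ (quo N (x − s•e_κ))`, definitional), `abs_ediv_sub_le_one`,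
`supNorm_quo_contour_le_one` (the block label along a contour moves by ≤ 1, in ONE coordinate — the same wobble in sup and ℓ¹),
**`abs_contourSumAdj_le_block`** (sup-on-blocks) ∕ **`abs_contourSumAdj_le_block_l1`** (block-ℓ¹): `|φ κ q| ≤ B·e^{−κ₀·dist(q, c)}` ⇒
`|(𝒬ᵀφ)_κ(x)| ≤ N·B·e^{κ₀}·e^{−κ₀·dist(quo N x, c)}`; `abs_contourSumAdj_sub_zsmul_le_l1` (the shifted argument `x − N•yy` of the `wH_EL` route);
**`abs_contourSumAdj_wPhi_le`**: from the (N3)∕`StencilSlotE3PhiLeg.phiLeg_coarse_of_unitDecayK`-shaped bound `|N^{2(d+1)}·KInv_N (N•x′) (N•z′) (inr α) (inr β)|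
≤ CΦ·e^{−δ|x′−z′|₁}`, the Φ-part `(𝒬ᵀ wΦ(·,μ,·))_κ(x − N•yy)` is `≤ N·(CΦ·(N^{2(d+1)})⁻¹)·e^{δ}·e^{−δ|quo N x − yy|₁}` — unit `N^{−(2d+1)}`·CΦ.
-/

noncomputable section

open Finset
open scoped BigOperators
open Literature.MathematicalPhysics.QuantumFieldTheory.LatticeForm (quo)
open Literature.MathematicalPhysics.QuantumFieldTheory.Balaban1983to89
open Literature.MathematicalPhysics.QuantumFieldTheory.Balaban1983to89.Beta
open B4ContourShift (supNorm abs_le_supNorm supNorm_nonneg exists_supNorm_eq)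
open B4Reflection242 (supNorm_add_le)
open BlochFibreUniqueness (quo_add_zsmul)
open KernelSpecInstance (wΦ)
open OneStepResolventKernel (Fib KInv KInv_inr_inr_coarse)
open B12Sec2to5 (l1 l1_nonneg)
open ExpKernelCalculus (l1_sub_triangle)

namespace Summit.QuantumFields.BalabanUV.Beta.GAN24.TaylorLamLegPhi

variable {d : ℕ}

/-! ## §1 (L1♯-b, asked for by the ROW-Λt holder leaf-10-g11, CLAIMS l.4711): THE Φ-PART SMEARING through `𝒬ᵀ`.
By `KernelSpecInstance.wH_EL` the multiplier-response leg of the Lagrange rows is `−(contourSumAdj N (wΦ(·, μ, ·)))_{κ″}(u − N•yy)`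
plus a gauge term (leaf-10's `lamCoeffOf_KInv_eq_EL`); `contourSumAdj N φ κ x = Σ_{s<N} φ κ (quo N (x − s•e_κ))` reads a COARSE 1-form
at the block labels of the `N` fine points of the contour through `(κ, x)`, so an ENTRYWISE block-decaying `φ` (the K-slot mm currency of
(N3) ∕ `StencilSlotE3PhiLeg.phiLeg_coarse_of_unitDecayK`) gives block decay with the unit multiplied by `N` and an `e^{κ}` wobble
(the label of `x − s•e_κ`, `s < N`, differs from `quo N x` by at most `1`, in the coordinate `κ` only — so the SAME wobble in both currencies). -/

/-- [folklore] `contourSumAdj` through the block label: `(𝒬ᵀφ)_κ(x) = Σ_{s<N} φ_κ (quo N (x − s•e_κ))` (definitional). -/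
theorem contourSumAdj_eq_sum_quo (N : ℕ) (φ : AffineAveraging.Form1 (d + 1) ℝ) (κ : Fin (d + 1)) (x : Fin (d + 1) → ℤ) :
    AffineReproduction.contourSumAdj N φ κ x =
      ∑ s ∈ Finset.range N, φ κ (quo N (x - (s : ℤ) • AffineAveraging.unitVec κ)) := rfl

/-- [folklore] For `0 ≤ s ≤ N`, `N ≥ 1`: `|(a − s)∕N − a∕N| ≤ 1`. -/
theorem abs_ediv_sub_le_one {N : ℕ} (hN : 1 ≤ N) (a : ℤ) {s : ℕ} (hs : s ≤ N) :
    |(a - (s : ℤ)) / (N : ℤ) - a / (N : ℤ)| ≤ 1 := by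
  have hN0 : (0 : ℤ) < N := by exact_mod_cast hN
  have hNne : (N : ℤ) ≠ 0 := hN0.ne'
  have hup : (a - (s : ℤ)) / (N : ℤ) ≤ a / (N : ℤ) := Int.ediv_le_ediv hN0 (by omega)
  have hdown : a / (N : ℤ) - 1 ≤ (a - (s : ℤ)) / (N : ℤ) := by
    have hsN : (s : ℤ) ≤ N := by exact_mod_cast hs
    calc a / (N : ℤ) - 1 = (a - (N : ℤ)) / (N : ℤ) := by
          rw [show a - (N : ℤ) = a + (-1) * (N : ℤ) by ring, Int.add_mul_ediv_right _ _ hNne]; ring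
      _ ≤ (a - (s : ℤ)) / (N : ℤ) := Int.ediv_le_ediv hN0 (by omega)
  rw [abs_le]; constructor <;> linarith

/-- [folklore] The block label along a contour: for `s < N`, `quo N (x − s•e_κ)` differs from `quo N x` by at most `1`, and ONLY in the
coordinate `κ` — so by at most `1` in BOTH the sup and the ℓ¹ norm. -/
theorem supNorm_quo_contour_le_one {N : ℕ} (hN : 1 ≤ N) (x : Fin (d + 1) → ℤ) (κ : Fin (d + 1)) {s : ℕ} (hs : s < N) :
    supNorm (quo N x - quo N (x - (s : ℤ) • AffineAveraging.unitVec κ)) ≤ 1 ∧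
      l1 (quo N x - quo N (x - (s : ℤ) • AffineAveraging.unitVec κ)) ≤ 1 := by
  have hcoord : ∀ i, |(quo N x - quo N (x - (s : ℤ) • AffineAveraging.unitVec κ)) i| ≤ if i = κ then 1 else 0 := by
    intro i
    simp only [quo, Pi.sub_apply, Pi.smul_apply, AffineAveraging.unitVec_apply, smul_eq_mul]
    by_cases hi : i = κ
    · rw [if_pos hi, mul_one, abs_sub_comm]
      exact abs_ediv_sub_le_one hN (x i) hs.le
    · rw [if_neg hi, mul_zero, sub_zero, sub_self, abs_zero]
  constructor
  · obtain ⟨i, hi⟩ := exists_supNorm_eq (quo N x - quo N (x - (s : ℤ) • AffineAveraging.unitVec κ))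
    rw [hi]
    have h := hcoord i
    have h1 : (if i = κ then (1 : ℤ) else 0) ≤ 1 := by split_ifs <;> norm_num
    exact_mod_cast h.trans h1
  · unfold l1
    calc ∑ i, |((quo N x - quo N (x - (s : ℤ) • AffineAveraging.unitVec κ)) i : ℝ)|
        ≤ ∑ i : Fin (d + 1), (if i = κ then (1 : ℝ) else 0) := Finset.sum_le_sum fun i _ => by
            have h := hcoord i
            have h' : (((|(quo N x - quo N (x - (s : ℤ) • AffineAveraging.unitVec κ)) i| : ℤ) : ℝ)) ≤
                ((if i = κ then (1 : ℤ) else 0 : ℤ) : ℝ) := by exact_mod_cast h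
            rw [Int.cast_abs] at h'
            refine h'.trans (le_of_eq ?_)
            split_ifs <;> simp
      _ = 1 := by simp

/-- [folklore] **THE Φ-PART SMEARING, SUP-ON-BLOCKS CURRENCY** (L1♯-b): a coarse 1-form with ENTRYWISE block decay around a centre `c`,
`|φ κ q| ≤ B·e^{−κ₀‖q − c‖∞}`, is read by `𝒬ᵀ` at the fine bond `(κ, x)` with the bound `N·B·e^{κ₀}·e^{−κ₀‖quo N x − c‖∞}` — the unit
`B` (e.g. (N3)'s `N^{−2(d+1)}` times the K-slot constant) is multiplied by the `N` incidences of the contour. -/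
theorem abs_contourSumAdj_le_block {N : ℕ} (hN : 1 ≤ N) {φ : AffineAveraging.Form1 (d + 1) ℝ} {B κ₀ : ℝ} (hB : 0 ≤ B) (hκ : 0 ≤ κ₀)
    (c : Fin (d + 1) → ℤ) (hφ : ∀ (κ : Fin (d + 1)) (q : Fin (d + 1) → ℤ), |φ κ q| ≤ B * Real.exp (-(κ₀ * supNorm (q - c))))
    (κ : Fin (d + 1)) (x : Fin (d + 1) → ℤ) :
    |AffineReproduction.contourSumAdj N φ κ x| ≤ (N : ℝ) * B * Real.exp κ₀ * Real.exp (-(κ₀ * supNorm (quo N x - c))) := by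
  rw [contourSumAdj_eq_sum_quo]
  have hterm : ∀ s ∈ Finset.range N, |φ κ (quo N (x - (s : ℤ) • AffineAveraging.unitVec κ))| ≤
      B * Real.exp κ₀ * Real.exp (-(κ₀ * supNorm (quo N x - c))) := by
    intro s hs
    set q := quo N (x - (s : ℤ) • AffineAveraging.unitVec κ) with hq
    have hw := (supNorm_quo_contour_le_one (d := d) hN x κ (Finset.mem_range.1 hs)).1
    have htri : supNorm (quo N x - c) ≤ supNorm (q - c) + 1 := by
      have h := supNorm_add_le (q - c) (quo N x - q)
      rw [show q - c + (quo N x - q) = quo N x - c by abel] at h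
      linarith
    calc |φ κ q| ≤ B * Real.exp (-(κ₀ * supNorm (q - c))) := hφ κ q
      _ ≤ B * (Real.exp κ₀ * Real.exp (-(κ₀ * supNorm (quo N x - c)))) := by
          refine mul_le_mul_of_nonneg_left ?_ hB
          rw [← Real.exp_add]
          exact Real.exp_le_exp.mpr (by nlinarith)
      _ = _ := by ring
  calc |∑ s ∈ Finset.range N, φ κ (quo N (x - (s : ℤ) • AffineAveraging.unitVec κ))|
      ≤ ∑ s ∈ Finset.range N, |φ κ (quo N (x - (s : ℤ) • AffineAveraging.unitVec κ))| := Finset.abs_sum_le_sum_abs _ _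
    _ ≤ ∑ _s ∈ Finset.range N, B * Real.exp κ₀ * Real.exp (-(κ₀ * supNorm (quo N x - c))) := Finset.sum_le_sum hterm
    _ = _ := by rw [Finset.sum_const, Finset.card_range, nsmul_eq_mul]; ring

/-- [folklore] **THE Φ-PART SMEARING, BLOCK-ℓ¹ CURRENCY** (the K-slot's and `StencilSlotE3PhiLeg`'s currency): `|φ κ q| ≤ B·e^{−κ₀|q − c|₁}` ⇒
`|(𝒬ᵀφ)_κ(x)| ≤ N·B·e^{κ₀}·e^{−κ₀|quo N x − c|₁}` — the SAME wobble `e^{κ₀}` (only the coordinate `κ` of the label moves). -/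
theorem abs_contourSumAdj_le_block_l1 {N : ℕ} (hN : 1 ≤ N) {φ : AffineAveraging.Form1 (d + 1) ℝ} {B κ₀ : ℝ} (hB : 0 ≤ B) (hκ : 0 ≤ κ₀)
    (c : Fin (d + 1) → ℤ) (hφ : ∀ (κ : Fin (d + 1)) (q : Fin (d + 1) → ℤ), |φ κ q| ≤ B * Real.exp (-(κ₀ * l1 (q - c))))
    (κ : Fin (d + 1)) (x : Fin (d + 1) → ℤ) :
    |AffineReproduction.contourSumAdj N φ κ x| ≤ (N : ℝ) * B * Real.exp κ₀ * Real.exp (-(κ₀ * l1 (quo N x - c))) := by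
  rw [contourSumAdj_eq_sum_quo]
  have hterm : ∀ s ∈ Finset.range N, |φ κ (quo N (x - (s : ℤ) • AffineAveraging.unitVec κ))| ≤
      B * Real.exp κ₀ * Real.exp (-(κ₀ * l1 (quo N x - c))) := by
    intro s hs
    set q := quo N (x - (s : ℤ) • AffineAveraging.unitVec κ) with hq
    have hw := (supNorm_quo_contour_le_one (d := d) hN x κ (Finset.mem_range.1 hs)).2
    have htri : l1 (quo N x - c) ≤ l1 (q - c) + 1 := by
      have h := l1_sub_triangle (quo N x) q c
      linarith
    calc |φ κ q| ≤ B * Real.exp (-(κ₀ * l1 (q - c))) := hφ κ q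
      _ ≤ B * (Real.exp κ₀ * Real.exp (-(κ₀ * l1 (quo N x - c)))) := by
          refine mul_le_mul_of_nonneg_left ?_ hB
          rw [← Real.exp_add]
          exact Real.exp_le_exp.mpr (by nlinarith)
      _ = _ := by ring
  calc |∑ s ∈ Finset.range N, φ κ (quo N (x - (s : ℤ) • AffineAveraging.unitVec κ))|
      ≤ ∑ s ∈ Finset.range N, |φ κ (quo N (x - (s : ℤ) • AffineAveraging.unitVec κ))| := Finset.abs_sum_le_sum_abs _ _
    _ ≤ ∑ _s ∈ Finset.range N, B * Real.exp κ₀ * Real.exp (-(κ₀ * l1 (quo N x - c))) := Finset.sum_le_sum hterm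
    _ = _ := by rw [Finset.sum_const, Finset.card_range, nsmul_eq_mul]; ring

/-- [folklore] THE SHIFTED ARGUMENT of the `wH_EL` route: at the fine point `x − N•yy` the label is `quo N x − yy`, so the Φ-part
`(𝒬ᵀ wΦ(·, μ, ·))_κ(x − N•yy)` of the multiplier response at the coarse bond `(μ, yy)` decays from the block of `x` to `yy`
(block-ℓ¹ currency; `φ` centred at `0`, as `wΦ κ μ ·` is). -/
theorem abs_contourSumAdj_sub_zsmul_le_l1 {N : ℕ} [NeZero N] {φ : AffineAveraging.Form1 (d + 1) ℝ} {B κ₀ : ℝ} (hB : 0 ≤ B) (hκ : 0 ≤ κ₀)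
    (hφ : ∀ (κ : Fin (d + 1)) (q : Fin (d + 1) → ℤ), |φ κ q| ≤ B * Real.exp (-(κ₀ * l1 q)))
    (κ : Fin (d + 1)) (x yy : Fin (d + 1) → ℤ) :
    |AffineReproduction.contourSumAdj N φ κ (x - (N : ℤ) • yy)| ≤ (N : ℝ) * B * Real.exp κ₀ * Real.exp (-(κ₀ * l1 (quo N x - yy))) := by
  have hN : 1 ≤ N := Nat.one_le_iff_ne_zero.2 (NeZero.ne N)
  have hφ0 : ∀ (κ : Fin (d + 1)) (q : Fin (d + 1) → ℤ), |φ κ q| ≤ B * Real.exp (-(κ₀ * l1 (q - 0))) := fun κ q => by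
    rw [sub_zero]; exact hφ κ q
  have h := abs_contourSumAdj_le_block_l1 (d := d) hN hB hκ 0 hφ0 κ (x - (N : ℤ) • yy)
  have hq : quo N (x - (N : ℤ) • yy) = quo N x - yy := by
    rw [sub_eq_add_neg x, ← smul_neg, quo_add_zsmul, sub_eq_add_neg]
  rw [hq, sub_zero] at h
  exact h

/-- [folklore] **THE Φ-PART OF THE LAGRANGE-ROW LEG IN THE K-SLOT mm CURRENCY**: from an (N3)∕`StencilSlotE3PhiLeg.phiLeg_coarse_of_unitDecayK`-shaped
hypothesis on the normalised mm block of the packed resolvent, `|N^{2(d+1)}·KInv_N (N•x′) (N•z′) (inr α) (inr β)| ≤ CΦ·e^{−δ|x′ − z′|₁}`, the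
coarse 1-form `q ↦ wΦ_N κ μ q` (`= KInv_N (N•q) (N•0) (inr κ) (inr μ)`, `KInv_inr_inr_coarse`) obeys `|wΦ κ μ q| ≤ CΦ·(N^{2(d+1)})⁻¹·e^{−δ|q|₁}`, and
hence `|(𝒬ᵀ wΦ(·, μ, ·))_κ(x − N•yy)| ≤ N·(CΦ·(N^{2(d+1)})⁻¹)·e^{δ}·e^{−δ|quo N x − yy|₁}` — unit `N·N^{−2(d+1)} = N^{−(2d+1)}`, the size the
three power counts (leaf-09-g15 l.4662, leaf-10-g11 l.4674, leaf-13-g17 l.4692) found necessary for the Λ rows. -/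
theorem abs_contourSumAdj_wPhi_le {N : ℕ} [NeZero N] {CΦ δ : ℝ} (hC : 0 ≤ CΦ) (hδ : 0 ≤ δ)
    (hΦ : ∀ (x' z' : Fin (d + 1) → ℤ) (α β : Fin (d + 1)),
      |((N : ℝ) ^ (2 * (d + 1))) * KInv (N := N) (d := d) ((N : ℤ) • x') ((N : ℤ) • z') (Sum.inr α) (Sum.inr β)| ≤
        CΦ * Real.exp (-δ * l1 (x' - z')))
    (μ κ : Fin (d + 1)) (x yy : Fin (d + 1) → ℤ) :
    |AffineReproduction.contourSumAdj N (fun κ q => wΦ (N := N) κ μ q) κ (x - (N : ℤ) • yy)| ≤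
      (N : ℝ) * (CΦ * (((N : ℝ) ^ (2 * (d + 1))))⁻¹) * Real.exp δ * Real.exp (-(δ * l1 (quo N x - yy))) := by
  have hNpos : (0 : ℝ) < (N : ℝ) ^ (2 * (d + 1)) := by
    have : (0 : ℝ) < N := by exact_mod_cast Nat.pos_of_ne_zero (NeZero.ne N)
    positivity
  set U : ℝ := ((N : ℝ) ^ (2 * (d + 1))) with hU
  have hwΦ : ∀ (κ' : Fin (d + 1)) (q : Fin (d + 1) → ℤ), |wΦ (N := N) κ' μ q| ≤ CΦ * U⁻¹ * Real.exp (-(δ * l1 q)) := by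
    intro κ' q
    have h := hΦ q 0 κ' μ
    rw [KInv_inr_inr_coarse, sub_zero, abs_mul, abs_of_pos hNpos] at h
    have e : -(δ * l1 q) = -δ * l1 q := by ring
    rw [e]
    have hUinv : 0 ≤ U⁻¹ := inv_nonneg.2 hNpos.le
    calc |wΦ (N := N) κ' μ q| = U⁻¹ * (U * |wΦ (N := N) κ' μ q|) := by
          rw [← mul_assoc, inv_mul_cancel₀ hNpos.ne', one_mul]
      _ ≤ U⁻¹ * (CΦ * Real.exp (-δ * l1 q)) := mul_le_mul_of_nonneg_left h hUinv
      _ = CΦ * U⁻¹ * Real.exp (-δ * l1 q) := by ring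
  exact abs_contourSumAdj_sub_zsmul_le_l1 (d := d) (mul_nonneg hC (inv_nonneg.2 hNpos.le)) hδ hwΦ κ x yy

end Summit.QuantumFields.BalabanUV.Beta.GAN24.TaylorLamLegPhi

end
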